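import Literature.MathematicalPhysics.QuantumFieldTheory.Balaban1983to89.B11SectGGlobal

/-!
# `Balaban1983to89.B11SectGGlobalSizes` — generic JUMP-FREE SIZE families for the global-form majorant algebra `B11SectGGlobal`: the block sup size, the
# PAIR size (weighted differences over a pair domain, BOTH ends read on the unrestricted vector) and their sum; the lemmas by which pointwise ∕ pairwise
# output estimates of the printed shape feed a `HasMajG`

[4] = T. Bałaban, *Propagators and renormalization transformations for lattice gauge theories. II*, Commun. Math. Phys. **96** (1984) 223–250
[`Balaban1984PropagatorsII`]; [B9] = T. Bałaban, *Propagators for lattice gauge theories in a background field*, Commun. Math. Phys. **99** (1985) 389–434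
[`Balaban1985BackgroundPropagators`].

statement-level skeleton of published theorems with citation tags; proofs where landed; nothing here is a claim about the
Yang–Mills mass gap

THE PRINTED LOCI.  [B9] (3.39)–(3.40) p. 397: *"|λ| = sup_x |λ(x)|"*, *"‖λ‖_β = max sup |R(U(Γ_{x,x′}))λ(x′) − λ(x)| ∕ |x − x′|^β"* (the pair quotient); (3.43)–(3.45)
p. 398: the output side of the Hölder entries reads DIFFERENCES of the output at pairs near `y` (behind a smooth `ζ`), the input side a support condition;
[4] (2.51)–(2.53) p. 232 (block majorants and their use), (2.137) p. 247 (the pair parameter).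

WHY THIS FILE (cell `pub-ymgap`, node N06; second half of the kernel piece worded WANTED by the knit owner dag-n06-d g12 — «generic, no pins, no schema
re-typing»).  `B11SectGGlobal` types the localisation-free currency `Size ∕ HasMajG`; THIS FILE supplies the generic size families a Hölder-type
INTERMEDIATE is made of, over ANY finite carrier `X` with a block MEMBERSHIP relation `mem : X → 𝔅 → Prop` (a block map `blk x = y`, or a class relation
with several index bonds per block such as n06-d's `RelB (sI p.1) y`):
* §1 ★ `Size.ofSup g mem` (`sz y f := ⨆_x [mem x y]·|f x|`; `= (BlockNorm.ofBlocks g blk).toSize` value by value for `mem x y := blk x = y`); ★ `Size.ofPairs g mem P w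
  hw` — `sz y f := ⨆_{(z,z′)} [mem z y ∧ P z z′]·w z z′·|f z − f z′|`, the partner `z′` read at its TRUE value wherever it lies (no zero-extension, hence NO
  class-boundary jump — contrast `B9CoReadingCoordsInputJump.loc_bHS_ge_jump` for the sharp-cut classes); `Size.supPairs g mem P w hw W hW := (ofSup).weight W
  + ofPairs` (the shape «`W(y)·sup_{Δ(y)}|f| + sup_pairs w·|Δf|`» of (3.39)–(3.40) with the power `W(y) = (Lʲη)^{−p}` inside, p. 398);
* §2 term lemmas (`ofSup_abs_le ∕ ofSup_sz_le`, `ofPairs_term_le ∕ ofPairs_sz_le`, `supPairs_sz`) and the FEEDING lemmas ★ `hasMajG_ofSup_of_pointBound`,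
  ★ `hasMajG_ofPairs_of_pairBound`, `hasMajG_supPairs_of_bounds`: a global majorant INTO these sizes from pointwise ∕ pairwise bounds of the output by the
  kernel-weighted input profile — the form in which a (3.43)∕(3.45)-type estimate is stated.
Which carrier, membership, pair domain and weight (def-Y's `XSK` with `RelB`, the η-scale `wS` or the ξ-scale `t^{−γ}`, admissible pairs) instantiate a
certificate's Hölder intermediate is the SCHEMA OWNER's word — not in this file.
HONEST SCOPE.  Generic finite-dimensional bookkeeping; nothing of [4] or [B9] asserted; no pin, no schema; COUNT-NEUTRAL; N06 NOT discharged; nothing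
continuum, nothing about the mass gap.  Cell `pub-ymgap` (HUMAN RULING D-0062), Track A node N06 [B9], width seat `pub-ymgap-dag-n06-w6` (g2), 2026-08-28.
-/

noncomputable section

namespace Literature.MathematicalPhysics.QuantumFieldTheory.Balaban1983to89.B11SectGGlobalSizes

open Finset B6RandomWalk
open B11SectG (BlockNorm HasMaj)
open B11SectGGlobal (Size HasMajG)

variable {g : B6.Geometry} {X : Type} [Fintype X]
variable {F₁ : Type} [AddCommGroup F₁] [Module ℝ F₁]

/-! ## §1 The sup size, the pair size, their sum -/

/-- ★ The block SUP size `sz y f = sup_{mem x y} |f x|` over a membership relation (jump-free: a sup does not read any partner's value).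
[cite: Balaban1985BackgroundPropagators, (3.39) p.397; Balaban1984PropagatorsII, (2.51) p.232] -/
def Size.ofSup (g : B6.Geometry) (mem : X → g.Site → Prop) [∀ x y, Decidable (mem x y)] : Size g (X → ℝ) where
  sz y f := ⨆ x : X, if mem x y then |f x| else 0
  nonneg y f := Real.iSup_nonneg fun x => by split_ifs; exacts [abs_nonneg _, le_rfl]
  zero y := by simp only [Pi.zero_apply, abs_zero, ite_self, Real.iSup_const_zero]
  add_le y f f' := by
    have h0 : 0 ≤ (⨆ x : X, if mem x y then |f x| else 0) := Real.iSup_nonneg fun x => by split_ifs; exacts [abs_nonneg _, le_rfl]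
    have h0' : 0 ≤ (⨆ x : X, if mem x y then |f' x| else 0) := Real.iSup_nonneg fun x => by split_ifs; exacts [abs_nonneg _, le_rfl]
    refine Real.iSup_le (fun x => ?_) (add_nonneg h0 h0')
    have hF := le_ciSup (f := fun x : X => if mem x y then |f x| else 0) (Finite.bddAbove_range _) x
    have hF' := le_ciSup (f := fun x : X => if mem x y then |f' x| else 0) (Finite.bddAbove_range _) x
    split_ifs with h
    · rw [if_pos h] at hF hF'
      exact (abs_add_le (f x) (f' x)).trans (add_le_add hF hF')
    · exact add_nonneg h0 h0'
  neg y f := by simp only [Pi.neg_apply, abs_neg]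

/-- for a block MAP the sup size is the size family under `BlockNorm.ofBlocks`, value by value. [cite: Balaban1984PropagatorsII, (2.51) p.232, dictionary] -/
theorem ofSup_blk_sz [DecidableEq g.Site] (blk : X → g.Site) (y : g.Site) (f : X → ℝ) :
    (Size.ofSup g (fun x y => blk x = y)).sz y f = (BlockNorm.ofBlocks g blk).toSize.sz y f := by
  unfold Size.ofSup BlockNorm.ofBlocks
  simp only [B11SectGGlobal.toSize_sz]
  congr 1; funext x; congr 1

/-- ★ **THE PAIR SIZE**: `sz y f := ⨆_{(z,z′)} [mem z y ∧ P z z′]·w(z,z′)·|f z − f z′|` over a pair domain `P` with a weight `w ≥ 0` (e.g. `|z − z′|^{−β}` at the η- or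
the ξ-scale), BOTH ends read on the unrestricted vector — the jump-free reading of the Hölder part `‖λ‖_β` of (3.40) near `y`.
[cite: Balaban1985BackgroundPropagators, (3.40) p.397; Balaban1984PropagatorsII, (2.137) p.247] -/
def Size.ofPairs (g : B6.Geometry) (mem : X → g.Site → Prop) [∀ x y, Decidable (mem x y)] (P : X → X → Prop) [DecidableRel P] (w : X → X → ℝ)
    (hw : ∀ z z', 0 ≤ w z z') : Size g (X → ℝ) where
  sz y f := ⨆ p : X × X, if mem p.1 y ∧ P p.1 p.2 then w p.1 p.2 * |f p.1 - f p.2| else 0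
  nonneg y f := Real.iSup_nonneg fun p => by
    split_ifs
    · exact mul_nonneg (hw _ _) (abs_nonneg _)
    · exact le_rfl
  zero y := by simp only [Pi.zero_apply, sub_zero, abs_zero, mul_zero, ite_self, Real.iSup_const_zero]
  add_le y f f' := by
    have h0 : 0 ≤ (⨆ p : X × X, if mem p.1 y ∧ P p.1 p.2 then w p.1 p.2 * |f p.1 - f p.2| else 0) :=
      Real.iSup_nonneg fun p => by split_ifs; exacts [mul_nonneg (hw _ _) (abs_nonneg _), le_rfl]
    have h0' : 0 ≤ (⨆ p : X × X, if mem p.1 y ∧ P p.1 p.2 then w p.1 p.2 * |f' p.1 - f' p.2| else 0) :=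
      Real.iSup_nonneg fun p => by split_ifs; exacts [mul_nonneg (hw _ _) (abs_nonneg _), le_rfl]
    refine Real.iSup_le (fun p => ?_) (add_nonneg h0 h0')
    have hF := le_ciSup (f := fun p : X × X => if mem p.1 y ∧ P p.1 p.2 then w p.1 p.2 * |f p.1 - f p.2| else 0) (Finite.bddAbove_range _) p
    have hF' := le_ciSup (f := fun p : X × X => if mem p.1 y ∧ P p.1 p.2 then w p.1 p.2 * |f' p.1 - f' p.2| else 0) (Finite.bddAbove_range _) p
    split_ifs with h
    · rw [if_pos h] at hF hF'
      simp only [Pi.add_apply]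
      calc w p.1 p.2 * |f p.1 + f' p.1 - (f p.2 + f' p.2)| ≤ w p.1 p.2 * (|f p.1 - f p.2| + |f' p.1 - f' p.2|) := by
            refine mul_le_mul_of_nonneg_left ?_ (hw _ _)
            calc _ = |(f p.1 - f p.2) + (f' p.1 - f' p.2)| := by ring_nf
              _ ≤ _ := abs_add_le _ _
        _ ≤ _ := by rw [mul_add]; exact add_le_add hF hF'
    · exact add_nonneg h0 h0'
  neg y f := by simp only [Pi.neg_apply, neg_sub_neg, abs_sub_comm]

/-- ★ **THE HÖLDER-TYPE SIZE** `W(y)·sup_{Δ(y)}|f| + sup_pairs w·|f z − f z′|` (the power `(Lʲη)^{−p}` inside the sup part, p. 398 *"conventional"*) — jump-free.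
[cite: Balaban1985BackgroundPropagators, (3.39)–(3.40) p.397 + p.398 (remark after (3.47))] -/
def Size.supPairs (g : B6.Geometry) (mem : X → g.Site → Prop) [∀ x y, Decidable (mem x y)] (P : X → X → Prop) [DecidableRel P] (w : X → X → ℝ)
    (hw : ∀ z z', 0 ≤ w z z') (W : g.Site → ℝ) (hW : ∀ y, 0 ≤ W y) : Size g (X → ℝ) :=
  ((Size.ofSup g mem).weight W hW).add (Size.ofPairs g mem P w hw)

/-! ## §2 Term lemmas and the feeding lemmas -/

section Terms

variable (mem : X → g.Site → Prop) [∀ x y, Decidable (mem x y)] (P : X → X → Prop) [DecidableRel P] (w : X → X → ℝ) (hw : ∀ z z', 0 ≤ w z z')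

/-- every value in the block is below the sup size. [cite: Balaban1985BackgroundPropagators, (3.39) p.397, bookkeeping] -/
theorem ofSup_abs_le {y : g.Site} {x : X} (hx : mem x y) (f : X → ℝ) : |f x| ≤ (Size.ofSup g mem).sz y f := by
  have h := le_ciSup (f := fun x : X => if mem x y then |f x| else 0) (Finite.bddAbove_range _) x
  simp only [if_pos hx] at h
  exact h

/-- the sup size is below any common bound `M ≥ 0` of the values in the block. [cite: Balaban1985BackgroundPropagators, (3.39) p.397, bookkeeping] -/
theorem ofSup_sz_le {y : g.Site} {f : X → ℝ} {M : ℝ} (hM : 0 ≤ M) (h : ∀ x, mem x y → |f x| ≤ M) : (Size.ofSup g mem).sz y f ≤ M := by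
  refine Real.iSup_le (fun x => ?_) hM
  split_ifs with hx
  · exact h x hx
  · exact hM

/-- every weighted pair difference of the domain is below the pair size. [cite: Balaban1985BackgroundPropagators, (3.40) p.397, bookkeeping] -/
theorem ofPairs_term_le {y : g.Site} {z z' : X} (hz : mem z y) (hP : P z z') (f : X → ℝ) :
    w z z' * |f z - f z'| ≤ (Size.ofPairs g mem P w hw).sz y f := by
  have h := le_ciSup (f := fun p : X × X => if mem p.1 y ∧ P p.1 p.2 then w p.1 p.2 * |f p.1 - f p.2| else 0) (Finite.bddAbove_range _) (z, z')
  simp only [if_pos (And.intro hz hP)] at h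
  exact h

/-- the pair size is below any common bound `M ≥ 0` of the weighted pair differences — in particular it is SMALL for an output with small differences near
`y`, wherever the partners lie (no jump). [cite: Balaban1985BackgroundPropagators, (3.40) p.397, bookkeeping] -/
theorem ofPairs_sz_le {y : g.Site} {f : X → ℝ} {M : ℝ} (hM : 0 ≤ M) (h : ∀ z z', mem z y → P z z' → w z z' * |f z - f z'| ≤ M) :
    (Size.ofPairs g mem P w hw).sz y f ≤ M := by
  refine Real.iSup_le (fun p => ?_) hM
  split_ifs with hp
  · exact h p.1 p.2 hp.1 hp.2
  · exact hM

/-- the Hölder-type size unfolds as `W y·(sup size) + (pair size)`. [cite: Balaban1985BackgroundPropagators, (3.39)–(3.40) p.397, bookkeeping] -/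
@[simp] theorem supPairs_sz (W : g.Site → ℝ) (hW : ∀ y, 0 ≤ W y) (y : g.Site) (f : X → ℝ) :
    (Size.supPairs g mem P w hw W hW).sz y f = W y * (Size.ofSup g mem).sz y f + (Size.ofPairs g mem P w hw).sz y f := rfl

variable {s₁ : Size g F₁} {T : F₁ →ₗ[ℝ] (X → ℝ)} {K : g.Site → g.Site → ℝ}

/-- ★ **FEEDING THE SUP SIZE**: a pointwise bound of the output by the kernel-weighted input profile, `|(T f)(x)| ≤ Σ_b K(y,b)·s₁ b f` for `x` in the block of
`y` (`K ≥ 0`), IS a global majorant into `Size.ofSup`. [cite: Balaban1984PropagatorsII, (2.51)–(2.53) p.232; Balaban1985BackgroundPropagators, (3.42) p.397] -/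
theorem hasMajG_ofSup_of_pointBound (hK : ∀ a b, 0 ≤ K a b)
    (h : ∀ (f : F₁) (y : g.Site) (x : X), mem x y → |T f x| ≤ ∑ b : g.Site, K y b * s₁.sz b f) : HasMajG s₁ (Size.ofSup g mem) T K :=
  fun f y => ofSup_sz_le mem (Finset.sum_nonneg fun b _ => mul_nonneg (hK y b) (s₁.nonneg b f)) (h f y)

/-- ★ **FEEDING THE PAIR SIZE**: a pairwise bound of the output differences, `w(z,z′)·|(T f)(z) − (T f)(z′)| ≤ Σ_b K(y,b)·s₁ b f` for `z` in the block of `y` and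
`P z z′` (`K ≥ 0`), IS a global majorant into `Size.ofPairs` — the shape of the output side of (3.43)∕(3.45). [cite: Balaban1984PropagatorsII, (2.51)–(2.53) p.232; Balaban1985BackgroundPropagators, (3.43)–(3.45) p.398] -/
theorem hasMajG_ofPairs_of_pairBound (hK : ∀ a b, 0 ≤ K a b)
    (h : ∀ (f : F₁) (y : g.Site) (z z' : X), mem z y → P z z' → w z z' * |T f z - T f z'| ≤ ∑ b : g.Site, K y b * s₁.sz b f) :
    HasMajG s₁ (Size.ofPairs g mem P w hw) T K :=
  fun f y => ofPairs_sz_le mem P w hw (Finset.sum_nonneg fun b _ => mul_nonneg (hK y b) (s₁.nonneg b f)) (h f y)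

/-- **FEEDING THE HÖLDER-TYPE SIZE**: a pointwise bound with kernel `K₀` (weighted by `W(y)`) and a pairwise bound with kernel `K₁` give the global majorant into
`Size.supPairs` with kernel `W(y)·K₀ + K₁`. [cite: Balaban1984PropagatorsII, (2.51)–(2.53) p.232; Balaban1985BackgroundPropagators, (3.42)–(3.45) pp.397–398] -/
theorem hasMajG_supPairs_of_bounds {K₀ K₁ : g.Site → g.Site → ℝ} (W : g.Site → ℝ) (hW : ∀ y, 0 ≤ W y) (hK₀ : ∀ a b, 0 ≤ K₀ a b) (hK₁ : ∀ a b, 0 ≤ K₁ a b)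
    (h₀ : ∀ (f : F₁) (y : g.Site) (x : X), mem x y → |T f x| ≤ ∑ b : g.Site, K₀ y b * s₁.sz b f)
    (h₁ : ∀ (f : F₁) (y : g.Site) (z z' : X), mem z y → P z z' → w z z' * |T f z - T f z'| ≤ ∑ b : g.Site, K₁ y b * s₁.sz b f) :
    HasMajG s₁ (Size.supPairs g mem P w hw W hW) T (fun a b => W a * K₀ a b + K₁ a b) := by
  have hsup : HasMajG (s₁.weight (fun _ => (1 : ℝ)) fun _ => zero_le_one) ((Size.ofSup g mem).weight W hW) T (fun a b => W a * K₀ a b) :=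
    (hasMajG_ofSup_of_pointBound mem hK₀ h₀).weight (fun _ => zero_le_one) hW fun a b => by rw [mul_one]
  have hsup' : HasMajG s₁ ((Size.ofSup g mem).weight W hW) T (fun a b => W a * K₀ a b) := by
    intro f a
    have h1 := hsup f a
    simp only [B11SectGGlobal.Size.weight_sz, one_mul] at h1 ⊢
    exact h1
  exact hsup'.target_add (hasMajG_ofPairs_of_pairBound mem P w hw hK₁ h₁)

end Terms

end Literature.MathematicalPhysics.QuantumFieldTheory.Balaban1983to89.B11SectGGlobalSizes
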